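import Summits.AnomalousDissipation.AnomalousDissipation.Theorems.MomentLadder.Negative.Clauses
import Summits.AnomalousDissipation.AnomalousDissipation.Theorems.QuarticGate.Negative.Laminar
import Summits.AnomalousDissipation.AnomalousDissipation.Theses.MirrorVariety
import Literature.Analysis.FunctionSpaces.TorusEnstrophyTrilinear
import Literature.Analysis.FunctionSpaces.TorusTruncationH1
import Literature.Analysis.FluidPDE.ZerothLaw

/-!
# The steady corner of the loud rung: stub `stub_steadyCorner` of line `Sketch`
# (crux `MomentParity.MomentLadder`, stmt-AnomalousDissipation-11463)

`GalerkinSteadyZerothLaw → C⁺`: loud bounded Galerkin steady states `U` (the sibling route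
MirrorVariety's crux, stmt-AnomalousDissipation-2986) give the loud rung with one superlinear
enstrophy moment (`Ψ(x) = x²`), witnessed by the Dirac masses `δ_{[U]}` on `H = L²_σ(T³)`.
Every row of `δ_{[U]}` vanishes (linearity of the tested generator in the test field, generator =
flux along the smooth representative, and the tested steady Galerkin equations), the enstrophy of
`δ_{[U]}` is the deterministic `‖∇U‖²`, and the steady energy identity
`ν‖∇U‖² = ∫⟪f, U⟫ ≤ ‖f‖₂ √E` (test the equations against `U` itself; Cauchy–Schwarz) bounds it
uniformly in the resolution `N`, so `∫ Ψ(‖∇u‖²) dδ_{[U]} ≤ (‖f‖₂ √E / ν)²`.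
-/

set_option linter.dupNamespace false

noncomputable section

namespace Summit.AnomalousDissipation.AnomalousDissipation.Theorems.MomentLadder

open MeasureTheory Filter Topology Set
open scoped ENNReal NNReal InnerProductSpace RealInnerProductSpace Polynomial
open Literature.Analysis.FunctionSpaces Literature.Analysis.FluidPDE
open Summit.AnomalousDissipation.AnomalousDissipation.Theses.MomentParity
open Summit.AnomalousDissipation.AnomalousDissipation.Theorems.QuarticGate.Negative
open Summit.AnomalousDissipation.AnomalousDissipation.Theorems.MomentLadder.Negative

/-! ## Superlinearity of `x ↦ x²` on `ℝ≥0∞` -/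

/-- `x ↦ x²` is superlinear at `⊤` in `ℝ≥0∞`: `x² / x = x → ⊤` along `𝓝[≠] ⊤`. [folklore] -/
theorem tendsto_sq_div_self_nhdsWithin_top :
    Tendsto (fun x : ℝ≥0∞ => x ^ 2 / x) (𝓝[≠] ⊤) (𝓝 ⊤) := by
  have h1 : ∀ᶠ x in 𝓝[≠] (⊤ : ℝ≥0∞), x ≠ ⊤ := self_mem_nhdsWithin
  have h2 : ∀ᶠ x in 𝓝[≠] (⊤ : ℝ≥0∞), x ≠ 0 :=
    mem_nhdsWithin_of_mem_nhds ((lt_mem_nhds ENNReal.zero_lt_top).mono fun _ hx => hx.ne')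
  refine (tendsto_id.mono_left nhdsWithin_le_nhds).congr' ?_
  filter_upwards [h1, h2] with x hxT hx0
  show x = x ^ 2 / x
  rw [sq, ENNReal.mul_div_cancel_right hx0 hxT]

/-! ## The steady energy identity -/

/-- Green's first identity for a smooth real vector field on `T³`: `∫ ⟪U, ΔU⟫ = −‖∇U‖₂²`
(`Torus.gradNormSq`; from `Torus.integral_inner_laplacian_eq_neg_holds`). [folklore] -/
theorem integral_inner_self_laplacian_eq_neg_gradNormSq
    {U : UnitAddTorus (Fin 3) → EuclideanSpace ℝ (Fin 3)} (hU : Torus.IsSmooth U) :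
    ∫ x, ⟪U x, Torus.laplacian U x⟫_ℝ = -Torus.gradNormSq U := by
  have hint : ∀ i, Integrable (fun x => ‖Torus.partialDeriv i U x‖ ^ 2) volume := fun i =>
    ((hU.partialDeriv i).continuous.norm.pow 2).integrable_unitAddTorus
  rw [Torus.integral_inner_laplacian_eq_neg_holds hU, Torus.gradNormSq,
    integral_finsetSum _ fun i _ => hint i]

/-- **The steady energy identity.** If a smooth divergence-free field `U` solves the tested steady
equation against itself, `∫ (⟪U, (U·∇)U⟫ + ν ⟪U, ΔU⟫ + ⟪f, U⟫) = 0`, then `ν ‖∇U‖₂² = ∫ ⟪f, U⟫`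
(the transport term vanishes, `∫⟪(U·∇)U, U⟫ = 0`, and `∫⟪U, ΔU⟫ = −‖∇U‖₂²`). [folklore] -/
theorem steady_energy_identity {f U : UnitAddTorus (Fin 3) → EuclideanSpace ℝ (Fin 3)}
    (hf : Torus.IsSmooth f) (hU : Torus.IsSmooth U) (hdiv : Torus.IsDivFree U) {ν : ℝ}
    (hsteady : ∫ x, (⟪U x, Torus.convect U U x⟫_ℝ + ν * ⟪U x, Torus.laplacian U x⟫_ℝ +
      ⟪f x, U x⟫_ℝ) = 0) :
    ν * Torus.gradNormSq U = ∫ x, ⟪f x, U x⟫_ℝ := by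
  have hi1 : Integrable (fun x => ⟪U x, Torus.convect U U x⟫_ℝ) volume :=
    (hU.continuous.inner (hU.convect hU).continuous).integrable_unitAddTorus
  have hi2 : Integrable (fun x => ν * ⟪U x, Torus.laplacian U x⟫_ℝ) volume :=
    ((hU.continuous.inner hU.laplacian.continuous).integrable_unitAddTorus).const_mul ν
  have hi3 : Integrable (fun x => ⟪f x, U x⟫_ℝ) volume :=
    (hf.continuous.inner hU.continuous).integrable_unitAddTorus
  have h1 : ∫ x, ⟪U x, Torus.convect U U x⟫_ℝ = 0 :=
    calc ∫ x, ⟪U x, Torus.convect U U x⟫_ℝ = ∫ x, ⟪Torus.convect U U x, U x⟫_ℝ :=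
          integral_congr_ae (ae_of_all _ fun x => real_inner_comm _ _)
      _ = 0 := Torus.integral_inner_convect_self_eq_zero hU hdiv
  have hi12 : Integrable (fun x => ⟪U x, Torus.convect U U x⟫_ℝ +
      ν * ⟪U x, Torus.laplacian U x⟫_ℝ) volume := hi1.add hi2
  rw [integral_add hi12 hi3, integral_add hi1 hi2, integral_const_mul, h1, zero_add,
    integral_inner_self_laplacian_eq_neg_gradNormSq hU] at hsteady
  linarith

/-! ## The Dirac mass at a loud bounded Galerkin steady state -/

/-- **The Dirac mass at a loud bounded Galerkin steady state is a witness of the loud rung with a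
quadratic enstrophy moment.** Let `f` be smooth, `ν > 0`, and let `U` be a smooth divergence-free
mean-zero field, band-limited to `0 < |k| ≤ N`, solving the tested Galerkin steady equations
`∫ (⟪U, (U·∇)a⟫ + ν ⟪U, Δa⟫ + ⟪f, a⟫) = 0` for all smooth divergence-free band-limited `a`, with
`∫‖U‖² ≤ E` and `ε ≤ ν‖∇U‖²`. Then `δ_{[U]}` is a probability law on `H`, carried by level-`N`
fields, supported in `‖u‖ ≤ √E`, polynomially stationary at every degree (each row is a
combination of tested steady equations), with `∫ (‖∇u‖²)² dδ = (‖∇U‖²)² ≤ (‖f‖₂ √E / ν)²` (steady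
energy identity and Cauchy–Schwarz), energy `∫‖U‖² ≤ E` and dissipation `ν‖∇U‖² ≥ ε`. [folklore] -/
theorem exists_dirac_witness_of_steady {f : UnitAddTorus (Fin 3) → EuclideanSpace ℝ (Fin 3)}
    (hfs : Torus.IsSmooth f) {ν : ℝ} (hν : 0 < ν) {N : ℕ} {E ε : ℝ}
    {U : UnitAddTorus (Fin 3) → EuclideanSpace ℝ (Fin 3)} (hUs : Torus.IsSmooth U)
    (hUd : Torus.IsDivFree U) (hUz : Torus.HasZeroMean U)
    (hUl : ∀ k ∉ (Torus.freqBall N).erase (0 : Fin 3 → ℤ),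
      UnitAddTorus.mFourierCoeff (EuclideanSpace.complexify ∘ U) k = 0)
    (hUeq : ∀ a : UnitAddTorus (Fin 3) → EuclideanSpace ℝ (Fin 3), Torus.IsSmooth a →
      Torus.IsDivFree a → (∀ k ∉ (Torus.freqBall N).erase (0 : Fin 3 → ℤ),
        UnitAddTorus.mFourierCoeff (EuclideanSpace.complexify ∘ a) k = 0) →
      ∫ x, (⟪U x, Torus.convect U a x⟫_ℝ + ν * ⟪U x, Torus.laplacian a x⟫_ℝ + ⟪f x, a x⟫_ℝ) = 0)
    (hUE : ∫ x, ‖U x‖ ^ 2 ≤ E) (hUε : ε ≤ ν * Torus.gradNormSq U) :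
    ∃ μ : Measure (Torus.energySpace (Fin 3)),
      IsProbabilityMeasure μ ∧ (∀ᵐ u ∂μ, IsLevel N u) ∧ IsSupported (Real.sqrt E) μ ∧
      (∀ d, IsPolyStationary ν f N d μ) ∧
      ∫⁻ u, Torus.eGradNormSq (u.1 : UnitAddTorus (Fin 3) → EuclideanSpace ℝ (Fin 3)) ^ 2 ∂μ ≤
        ENNReal.ofReal ((Real.sqrt (∫ x, ‖f x‖ ^ 2) * Real.sqrt E / ν) ^ 2) ∧
      Torus.ensembleEnergy μ ≤ E ∧ ε ≤ Torus.ensembleDissipation ν μ := by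
  haveI : MeasurableSingletonClass (Torus.energySpace (Fin 3)) :=
    OpensMeasurableSpace.toMeasurableSingletonClass
  -- the class of `U` in `H` (as in `QuarticGate.Negative.kolState`)
  obtain ⟨u₀, hae⟩ : ∃ u₀ : Torus.energySpace (Fin 3),
      (u₀.1 : UnitAddTorus (Fin 3) → EuclideanSpace ℝ (Fin 3)) =ᵐ[volume] U :=
    ⟨⟨(hUs.memLp 2).toLp U, Torus.smoothSolenoidal_subset_energySpace
      ⟨U, hUs, hUd, hUz, MemLp.coeFn_toLp (hUs.memLp 2)⟩⟩, MemLp.coeFn_toLp (hUs.memLp 2)⟩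
  -- energy of the state
  have hnorm : ‖u₀‖ ^ 2 = ∫ x, ‖U x‖ ^ 2 := by
    rw [show ‖u₀‖ = ‖u₀.1‖ from rfl, ← Torus.integral_norm_sq_coe_eq]
    exact integral_congr_ae (hae.mono fun x hx => by simp only [hx])
  have hnormle : ‖u₀‖ ≤ Real.sqrt E := by
    rw [← Real.sqrt_sq (norm_nonneg u₀), hnorm]
    exact Real.sqrt_le_sqrt hUE
  -- enstrophy of the state
  have hZ : Torus.eGradNormSq (u₀.1 : UnitAddTorus (Fin 3) → EuclideanSpace ℝ (Fin 3)) =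
      ENNReal.ofReal (Torus.gradNormSq U) := by
    rw [QuarticGate.Negative.eGradNormSq_congr_ae hae, Torus.eGradNormSq_eq_ofReal_gradNormSq hUs]
  -- the steady energy identity and the force ceiling `ν‖∇U‖² = ∫⟪f, U⟫ ≤ ‖f‖₂ √E`
  have hid : ν * Torus.gradNormSq U = ∫ x, ⟪f x, U x⟫_ℝ :=
    steady_energy_identity hfs hUs hUd (hUeq U hUs hUd hUl)
  have hpair : ∫ x, ⟪f x, U x⟫_ℝ = Torus.pairing u₀.1 f := by
    unfold Torus.pairing
    refine integral_congr_ae (hae.mono fun x hx => ?_)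
    show ⟪f x, U x⟫_ℝ = ⟪(u₀.1 : UnitAddTorus (Fin 3) → EuclideanSpace ℝ (Fin 3)) x, f x⟫_ℝ
    rw [hx, real_inner_comm]
  have hCS : ∫ x, ⟪f x, U x⟫_ℝ ≤ Real.sqrt (∫ x, ‖f x‖ ^ 2) * Real.sqrt E := by
    rw [hpair, ← CubicParityLoud.Negative.norm_toLp_eq_sqrt (hfs.memLp 2)]
    calc Torus.pairing u₀.1 f ≤ |Torus.pairing u₀.1 f| := le_abs_self _
      _ ≤ ‖u₀‖ * ‖(hfs.memLp 2).toLp f‖ := Torus.abs_pairing_coe_le (hfs.memLp 2) u₀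
      _ ≤ Real.sqrt E * ‖(hfs.memLp 2).toLp f‖ :=
          mul_le_mul_of_nonneg_right hnormle (norm_nonneg _)
      _ = ‖(hfs.memLp 2).toLp f‖ * Real.sqrt E := mul_comm _ _
  have hgrad : Torus.gradNormSq U ≤ Real.sqrt (∫ x, ‖f x‖ ^ 2) * Real.sqrt E / ν := by
    rw [le_div_iff₀ hν]
    linarith
  refine ⟨Measure.dirac u₀, inferInstance, ?_, ?_, ?_, ?_, ?_, ?_⟩
  · -- carried by level-`N` fields
    rw [ae_dirac_eq, eventually_pure]
    intro k hk
    rw [QuarticGate.Negative.mFourierCoeff_congr_ae hae k]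
    exact hUl k hk
  · -- supported in the ball of radius `√E`
    show ∀ᵐ u ∂Measure.dirac u₀, ‖u‖ ≤ Real.sqrt E
    rw [ae_dirac_eq, eventually_pure]
    exact hnormle
  · -- polynomially stationary at every degree
    intro d m g P hg _
    refine ⟨Torus.integrable_dirac _ _, ?_⟩
    rw [integral_dirac]
    show Torus.nsGeneratorPairing ν f u₀ (fun x => ∑ i : Fin m,
      (MvPolynomial.eval (fun j => Torus.pairing u₀.1 (g j)) (MvPolynomial.pderiv i P)) • g i x) = 0
    rw [Torus.nsGeneratorPairing_sum_smul ν hfs.integrable u₀ Finset.univ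
      (fun i => MvPolynomial.eval (fun j => Torus.pairing u₀.1 (g j)) (MvPolynomial.pderiv i P))
      fun i _ => (hg i).1]
    refine Finset.sum_eq_zero fun i _ => ?_
    rw [Torus.nsGeneratorPairing_eq_flux ν (hfs.memLp 2) (hg i).1 hae,
      hUeq (g i) (hg i).1 (hg i).2.1 (hg i).2.2.2, mul_zero]
  · -- the quadratic enstrophy moment
    rw [lintegral_dirac]
    show Torus.eGradNormSq (u₀.1 : UnitAddTorus (Fin 3) → EuclideanSpace ℝ (Fin 3)) ^ 2 ≤ _
    rw [hZ, ← ENNReal.ofReal_pow (Torus.gradNormSq_nonneg U)]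
    exact ENNReal.ofReal_le_ofReal (pow_le_pow_left₀ (Torus.gradNormSq_nonneg U) hgrad 2)
  · -- energy
    rw [Torus.ensembleEnergy, integral_dirac]
    show ‖u₀‖ ^ 2 ≤ E
    rw [hnorm]
    exact hUE
  · -- dissipation
    unfold Torus.ensembleDissipation Torus.ensembleEnstrophy
    rw [lintegral_dirac]
    show ε ≤ ν * (Torus.eGradNormSq (u₀.1 : UnitAddTorus (Fin 3) → EuclideanSpace ℝ (Fin 3))).toReal
    rw [hZ, ENNReal.toReal_ofReal (Torus.gradNormSq_nonneg U)]
    exact hUε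

/-! ## The stub -/

/-- **STUB `stub_steadyCorner` (the steady corner of the loud rung C⁺).** The Galerkin steady
zeroth law (`MirrorVariety.GalerkinSteadyZerothLaw`, stmt-AnomalousDissipation-2986: loud bounded
Galerkin steady states `U` at `(N, ν_j)` for infinitely many `N`, every `j`) implies the loud rung
with one superlinear enstrophy moment: keep `f, ν, E, ε`, take `Ψ(x) = x²`, `R = √E`,
`B_j = (‖f‖₂ √E / ν_j)²`, and the Dirac masses `δ_{[U]}` (`exists_dirac_witness_of_steady`). -/
theorem stub_steadyCorner :
    Summit.AnomalousDissipation.AnomalousDissipation.Theses.MirrorVariety.GalerkinSteadyZerothLaw →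
    ∃ f : UnitAddTorus (Fin 3) → EuclideanSpace ℝ (Fin 3),
      Torus.IsSmooth f ∧ Torus.IsDivFree f ∧ Torus.HasZeroMean f ∧
      ∃ (ν : ℕ → ℝ) (E ε : ℝ) (Ψ : ℝ≥0∞ → ℝ≥0∞),
        (∀ j, 0 < ν j) ∧ Tendsto ν atTop (𝓝 0) ∧ 0 < ε ∧
        Tendsto (fun x : ℝ≥0∞ => Ψ x / x) (𝓝[≠] ⊤) (𝓝 ⊤) ∧
        ∀ j : ℕ, ∃ (R : ℝ) (B : ℝ≥0∞), B < ⊤ ∧ ∃ᶠ N in atTop,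
          ∃ μ : Measure (Torus.energySpace (Fin 3)),
            IsProbabilityMeasure μ ∧ (∀ᵐ u ∂μ, IsLevel N u) ∧ IsSupported R μ ∧
            (∀ d, IsPolyStationary (ν j) f N d μ) ∧
            ∫⁻ u, Ψ (Torus.eGradNormSq (u.1 : UnitAddTorus (Fin 3) → EuclideanSpace ℝ (Fin 3))) ∂μ ≤ B ∧
            Torus.ensembleEnergy μ ≤ E ∧ ε ≤ Torus.ensembleDissipation (ν j) μ := by
  rintro ⟨f, hfs, hfd, hfz, ν, E, ε, hν, hν0, hε, hj⟩
  refine ⟨f, hfs, hfd, hfz, ν, E, ε, fun x => x ^ 2, hν, hν0, hε,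
    tendsto_sq_div_self_nhdsWithin_top, fun j => ?_⟩
  refine ⟨Real.sqrt E, ENNReal.ofReal ((Real.sqrt (∫ x, ‖f x‖ ^ 2) * Real.sqrt E / ν j) ^ 2),
    ENNReal.ofReal_lt_top, (hj j).mono fun N hN => ?_⟩
  obtain ⟨U, ⟨hUs, hUd, hUz, hUl, hUeq⟩, hUE, hUε⟩ := hN
  exact exists_dirac_witness_of_steady hfs (hν j) hUs hUd hUz hUl hUeq hUE hUε

end Summit.AnomalousDissipation.AnomalousDissipation.Theorems.MomentLadder

end
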